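import Literature.Probability.LatticeModels.FKIsingEdgeDensityDictionary
import Literature.Probability.LatticeModels.FKIsingWiredCriticalPoint
import Mathlib.Topology.Order.MonotoneConvergence
import HarnessLib

/-!
# The free percolation probability `θ⁰(p, q)` of the random-cluster model on `ℤ^d`, and
# `θ⁰(p, q) = θ¹(p, q)` at every parameter where the free and wired edge densities agree
# (Grimmett 2006, Thm. (5.16)(c)); the FK–Ising case `q = 2` at every `p`, from Raoufi's identity

Topic `Literature/Probability/LatticeModels`. The tree has the WIRED percolation probability
`θ¹(p,q) = inf_n φ¹_{Λ_n,p,q}(0 ↔ ∂Λ_n)` (`Literature.Barriers.CriticalPhenomena.thetaWired`,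
`RandomClusterFirstOrder.lean`; `= lim_n`, `tendsto_thetaWiredBox`, Grimmett 2006 Prop. (5.11)) and the
finite-volume form of Grimmett's uniqueness theorem Thm. (4.63) (c) ⇒ (d)
(`iInf_boxWiredReal_le_iSup_boxFreeReal`, `RandomClusterEdgeDensities.lean`: at a parameter `p` with
`h⁰(p,q) = h¹(p,q)`, every increasing box event has wired limit probability at most its free limit
probability). This file adds the FREE percolation probability and the boundary-condition seam:

* `thetaFreeBox d p q n k = φ⁰_{Λ_{n+k},p,q}(0 ↔ ∂Λ_n)` — the free measure of the box `Λ_{n+k}` (no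
  wiring) of the event that the origin is joined inside `Λ_n` to `∂Λ_n` (the tree's
  `boxFreeReal d p q n (originToBoundary d n) k`, the quantity of `freeDecaySet`);
  `thetaFreeArm d p q n = sup_k φ⁰_{Λ_{n+k},p,q}(0 ↔ ∂Λ_n)` (`= lim_k`, the free box measures increase
  with the box, Grimmett 2006 Thm. (4.19)(a) eq. (4.24); this is `φ⁰_{p,q}(0 ↔ ∂Λ_n)`);
  **`thetaFree d p q = θ⁰(p,q) := inf_n sup_k φ⁰_{Λ_{n+k},p,q}(0 ↔ ∂Λ_n)`** (`= lim_n`, the events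
  decrease in `n`; Grimmett 2006 (5.1) with `b = 0`: `θ⁰(p,q) = φ⁰_{p,q}(0 ↔ ∞)`).
* API: bounds, `thetaFreeBox` non-decreasing in `k` and convergent to `thetaFreeArm`,
  `thetaFreeArm` non-increasing in `n` and convergent to `thetaFree` (`0 ≤ p ≤ 1`, `q ≥ 1`);
  `thetaFree_eq_zero_iff_mem_freeDecaySet` (the barrier programme's `freeDecaySet d q` is
  `{p : θ⁰(p,q) = 0}`).
* `thetaFree_le_thetaWired` — **`θ⁰(p,q) ≤ θ¹(p,q)`** (free ≤ wired in one box, Grimmett 2006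
  Lemma (4.14)(b), and the wired box measures decrease with the box, (4.24) with `b = 1`).
* `thetaWired_le_thetaFreeArm_of_edgeDensity_eq`, **`thetaFree_eq_thetaWired_of_edgeDensity_eq`** —
  Grimmett 2006, **Thm. (5.16)(c), the 'if' half**: if `h⁰(p,q) = h¹(p,q)` (at every edge of `ℤ^d`;
  `p ∉ 𝒟_q` in the book's notation, Thm. (4.63) (a)⇔(c)), then `θ⁰(p,q) = θ¹(p,q)`
  (`d ≥ 1`, `0 ≤ p ≤ 1`, `q ≥ 1`). Proof as printed ("certainly `φ⁰_{p,q} = φ¹_{p,q}` if `p ∉ 𝒟_q`,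
  whence `θ⁰ = θ¹`"), in the tree's finite-volume language:
  `θ¹ ≤ inf_k φ¹_{Λ_{n+k}}(0 ↔ ∂Λ_n) ≤ sup_k φ⁰_{Λ_{n+k}}(0 ↔ ∂Λ_n)` for every `n`.
* The FK–Ising case `q = 2`, `p = 1 - e^{-2β}`: `thetaFree_eq_thetaWired_two_of_nn_freeCorr_eq_plusCorr`
  (from ONE nearest-neighbour identity `⟨σ_0σ_{eᵢ}⟩^∅_β = ⟨σ_0σ_{eᵢ}⟩⁺_β`, through the tree's
  Edwards–Sokal edge-density dictionary `freeEdgeDensity_eq_wiredEdgeDensity_of_nn_freeCorr_eq_plusCorr`),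
  **`thetaFree_eq_thetaWired_two_of_raoufi`** (every `β ≥ 0`, `d ≥ 1`, conditional on the tree's
  named fact `Raoufi2020_nn_freeCorr_eq_plusCorr` = Raoufi 2020, Prop. 1), and at the critical
  point: `thetaFree_rcCriticalProb_two_eq_thetaWired_of_raoufi` (`d ≥ 2`,
  `p_c(2) = 1 - e^{-2β_c}`), `thetaFree_rcCriticalProb_two_eq_zero_of_raoufi` (`d ≥ 3`:
  `θ⁰(p_c(2),2) = θ¹(p_c(2),2) = 0`, with `thetaWired_rcCriticalProb_two_eq_zero`).

Everything is proved; no named facts. The identification of the tree's `inf`/`sup` over boxes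
with Grimmett's `θ⁰ = φ⁰_{p,q}(0 ↔ ∞)` (a statement about the infinite-volume measure `φ⁰_{p,q}`,
Thm. (4.19)) stays informal, exactly as for `thetaWired` (Prop. (5.11)); the limits in `k` and
`n` are proved here. The 'only if' half of Thm. (5.16)(c) (`θ⁰ = θ¹ ⇒ h⁰ = h¹`, eqs.
(5.20)–(5.26)) is not formalised.

## References

* G. Grimmett, *The Random-Cluster Model*, Springer 2006: §4.2 (4.11)–(4.12), Lemma (4.14),
  Thm. (4.19)(a) with (4.24); (4.61), Thm. (4.63); §5.1 (5.1)–(5.4), Prop. (5.11); §5.2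
  Thm. (5.16) and its proof; Thm. (5.17) (5.19). [Grimmett2006]
* A. Raoufi, *Translation-invariant Gibbs states of the Ising model: general setting*, Ann.
  Probab. 48 (2020) 760–777, Prop. 1 and Cor. 3. [Raoufi2020]
* M. Aizenman, H. Duminil-Copin, V. Sidoravicius, Comm. Math. Phys. 334 (2015) 719–742,
  Thm. 1.2, Cor. 1.5(1). [AizenmanDuminilCopinSidoraviciusCMP2015]
-/

noncomputable section

open MeasureTheory Filter Topology
open Literature.Probability.Percolation Literature.Barriers.CriticalPhenomena

namespace Literature.Probability.LatticeModels

/-! ### Restriction of configurations along nested finite vertex sets composes -/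

section Restrict

variable {V : Type*}

/-- Restricting a configuration of `Θ` to `Δ ⊆ Θ` and then to `Λ ⊆ Δ` is restricting it to `Λ`.
[cite: Grimmett2006, §4.2 (configurations on E_Λ)] -/
theorem finsetRestrict_finsetRestrict {Λ Δ Θ : Finset V} (h₁ : Λ ⊆ Δ) (h₂ : Δ ⊆ Θ)
    (ω : Percolation.BondConfig ↥Θ) :
    finsetRestrict h₁ (finsetRestrict h₂ ω) = finsetRestrict (h₁.trans h₂) ω := by
  ext e
  induction e using Sym2.ind with
  | h a b =>
    simp only [mem_finsetRestrict_iff, edgeLift_mk]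
    exact Iff.rfl

/-- The restriction to `Λ ⊆ Δ` of a configuration carried by the edges of `(Δ, E_Δ)` is carried
by the edges of `(Λ, E_Λ)`. [cite: Grimmett2006, §4.2 (configurations on E_Λ)] -/
theorem finsetRestrict_subset_edgeSet {G : SimpleGraph V} {Λ Δ : Finset V} (h : Λ ⊆ Δ)
    {ω : Percolation.BondConfig ↥Δ} (hω : ω ⊆ (finsetGraph G Δ).edgeSet) :
    finsetRestrict h ω ⊆ (finsetGraph G Λ).edgeSet := by
  intro e he
  induction e using Sym2.ind with
  | h a b =>
    rw [SimpleGraph.mem_edgeSet, ← adj_finsetIncl_iff h]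
    have he' : edgeLift h s(a, b) ∈ ω := he
    rw [edgeLift_mk] at he'
    exact (SimpleGraph.mem_edgeSet _).1 (hω he')

end Restrict

variable {d : ℕ}

/-! ### The free box quantities and `θ⁰(p, q)` -/

section Defs

variable (d)

/-- `φ⁰_{Λ_{n+k},p,q}(0 ↔ ∂Λ_n)`: under the FREE random-cluster measure of the box `Λ_{n+k}` (no
wiring; Grimmett 2006 (4.11)–(4.12) with `ξ = 0`, here `rcMeasure … ∅`), the probability that the
origin is joined to `∂Λ_n` by an open path of `Λ_n` — the pull-back to `E_{Λ_{n+k}}` of the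
increasing local event `{0 ↔ ∂Λ_n}` (`originToBoundary d n`). This is the tree's
`boxFreeReal d p q n (originToBoundary d n) k`. [cite: Grimmett2006, §4.2 (4.11)–(4.12) (ξ = 0) and §5.1 (5.1)] -/
def thetaFreeBox (p q : ℝ) (n k : ℕ) : ℝ := boxFreeReal d p q n (originToBoundary d n) k

/-- `φ⁰_{p,q}(0 ↔ ∂Λ_n) := sup_k φ⁰_{Λ_{n+k},p,q}(0 ↔ ∂Λ_n)`: the free infinite-volume probability
of the local event `{0 ↔ ∂Λ_n}`. For `0 ≤ p ≤ 1`, `q ≥ 1` the free box measures increase with the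
box on increasing events (Grimmett 2006, Thm. (4.19)(a), eq. (4.24)), so the supremum is the
limit `k → ∞` (`tendsto_thetaFreeBox`), i.e. the `φ⁰_{p,q}`-probability of this cylinder event.
[cite: Grimmett2006, Thm. (4.19)(a) with (4.24), and §5.1 (5.1)] -/
def thetaFreeArm (p q : ℝ) (n : ℕ) : ℝ := ⨆ k : ℕ, thetaFreeBox d p q n k

/-- **The free percolation probability `θ⁰(p, q) = φ⁰_{p,q}(0 ↔ ∞)`** of the random-cluster model on
`ℤ^d` (Grimmett 2006, (5.1) with `b = 0`), written as
`inf_n sup_k φ⁰_{Λ_{n+k},p,q}(0 ↔ ∂Λ_n)`: `{0 ↔ ∞} = ⋂_n {0 ↔ ∂Λ_n}` is a decreasing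
intersection, so for `0 ≤ p ≤ 1`, `q ≥ 1` the infimum over `n` of
`φ⁰_{p,q}(0 ↔ ∂Λ_n) = thetaFreeArm d p q n` is the limit `n → ∞` (`tendsto_thetaFreeArm`).
The companion of the tree's wired `thetaWired d p q = θ¹(p,q) = inf_n φ¹_{Λ_n,p,q}(0 ↔ ∂Λ_n)`.
[cite: Grimmett2006, §5.1 (5.1) (b = 0) with Thm. (4.19)(a)] -/
def thetaFree (p q : ℝ) : ℝ := ⨅ n : ℕ, thetaFreeArm d p q n

end Defs

/-- `thetaFreeBox` is the tree's `boxFreeReal` of the event `originToBoundary` (definitional).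
[cite: Grimmett2006, §5.1 (5.1)] -/
theorem thetaFreeBox_eq (p q : ℝ) (n k : ℕ) :
    thetaFreeBox d p q n k = boxFreeReal d p q n (originToBoundary d n) k := rfl

/-- `thetaFreeBox` written out as a free box measure. [cite: Grimmett2006, §4.2 (4.11)–(4.12) (ξ = 0)] -/
theorem thetaFreeBox_eq_real (p q : ℝ) (n k : ℕ) :
    thetaFreeBox d p q n k =
      (rcMeasure (finsetGraph (zdGraph d) (box d (n + k))) p q ∅).real
        (finsetRestrict (box_mono d (Nat.le_add_right n k)) ⁻¹' originToBoundary d n) := rfl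

/-- `thetaFreeArm` unfolded. [cite: Grimmett2006, §5.1 (5.1)] -/
theorem thetaFreeArm_eq (p q : ℝ) (n : ℕ) :
    thetaFreeArm d p q n = ⨆ k : ℕ, thetaFreeBox d p q n k := rfl

/-- `thetaFree` unfolded. [cite: Grimmett2006, §5.1 (5.1)] -/
theorem thetaFree_eq (p q : ℝ) : thetaFree d p q = ⨅ n : ℕ, thetaFreeArm d p q n := rfl

/-! ### Bounds -/

section Bounds

/-- `0 ≤ φ⁰_{Λ_{n+k}}(0 ↔ ∂Λ_n)`. [cite: Grimmett2006, §4.2] -/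
theorem thetaFreeBox_nonneg (p q : ℝ) (n k : ℕ) : 0 ≤ thetaFreeBox d p q n k := measureReal_nonneg

/-- `φ⁰_{Λ_{n+k}}(0 ↔ ∂Λ_n) ≤ 1` (a probability, `0 ≤ p ≤ 1`, `q > 0`). [cite: Grimmett2006, §4.2] -/
theorem thetaFreeBox_le_one {p q : ℝ} (hp : p ∈ Set.Icc (0 : ℝ) 1) (hq : 0 < q) (n k : ℕ) :
    thetaFreeBox d p q n k ≤ 1 := boxFreeReal_le_one d hp hq n _ k

/-- The family `k ↦ φ⁰_{Λ_{n+k}}(0 ↔ ∂Λ_n)` is bounded above (by `1`). [cite: Grimmett2006, §4.2] -/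
theorem bddAbove_range_thetaFreeBox {p q : ℝ} (hp : p ∈ Set.Icc (0 : ℝ) 1) (hq : 0 < q) (n : ℕ) :
    BddAbove (Set.range fun k : ℕ => thetaFreeBox d p q n k) :=
  ⟨1, by rintro _ ⟨k, rfl⟩; exact thetaFreeBox_le_one hp hq n k⟩

/-- `0 ≤ φ⁰_{p,q}(0 ↔ ∂Λ_n)`. [cite: Grimmett2006, §5.1 (5.1)] -/
theorem thetaFreeArm_nonneg (p q : ℝ) (n : ℕ) : 0 ≤ thetaFreeArm d p q n :=
  Real.iSup_nonneg fun k => thetaFreeBox_nonneg p q n k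

/-- `φ⁰_{p,q}(0 ↔ ∂Λ_n) ≤ 1` (`0 ≤ p ≤ 1`, `q > 0`). [cite: Grimmett2006, §5.1 (5.1)] -/
theorem thetaFreeArm_le_one {p q : ℝ} (hp : p ∈ Set.Icc (0 : ℝ) 1) (hq : 0 < q) (n : ℕ) :
    thetaFreeArm d p q n ≤ 1 :=
  ciSup_le fun k => thetaFreeBox_le_one hp hq n k

/-- Each box quantity is below the supremum: `φ⁰_{Λ_{n+k}}(0 ↔ ∂Λ_n) ≤ φ⁰_{p,q}(0 ↔ ∂Λ_n)`
(`0 ≤ p ≤ 1`, `q > 0`). [cite: Grimmett2006, Thm. (4.19)(a)] -/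
theorem thetaFreeBox_le_thetaFreeArm {p q : ℝ} (hp : p ∈ Set.Icc (0 : ℝ) 1) (hq : 0 < q) (n k : ℕ) :
    thetaFreeBox d p q n k ≤ thetaFreeArm d p q n :=
  le_ciSup (bddAbove_range_thetaFreeBox hp hq n) k

/-- The family `n ↦ φ⁰_{p,q}(0 ↔ ∂Λ_n)` is bounded below (by `0`). [cite: Grimmett2006, §5.1 (5.1)] -/
theorem bddBelow_range_thetaFreeArm (p q : ℝ) :
    BddBelow (Set.range fun n : ℕ => thetaFreeArm d p q n) :=
  ⟨0, by rintro _ ⟨n, rfl⟩; exact thetaFreeArm_nonneg p q n⟩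

/-- `0 ≤ θ⁰(p,q)`. [cite: Grimmett2006, §5.1 (5.1)] -/
theorem thetaFree_nonneg (p q : ℝ) : 0 ≤ thetaFree d p q :=
  le_ciInf fun n => thetaFreeArm_nonneg p q n

/-- `θ⁰(p,q) ≤ φ⁰_{p,q}(0 ↔ ∂Λ_n)` for every `n` (the infimum is below each term).
[cite: Grimmett2006, §5.1 (5.1)] -/
theorem thetaFree_le_thetaFreeArm (p q : ℝ) (n : ℕ) : thetaFree d p q ≤ thetaFreeArm d p q n :=
  ciInf_le (bddBelow_range_thetaFreeArm p q) n

/-- `θ⁰(p,q) ≤ 1` (`0 ≤ p ≤ 1`, `q > 0`). [cite: Grimmett2006, §5.1 (5.1)] -/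
theorem thetaFree_le_one {p q : ℝ} (hp : p ∈ Set.Icc (0 : ℝ) 1) (hq : 0 < q) : thetaFree d p q ≤ 1 :=
  (thetaFree_le_thetaFreeArm p q 0).trans (thetaFreeArm_le_one hp hq 0)

end Bounds

/-! ### Monotonicity in the box and the limits `k → ∞`, `n → ∞` -/

section Monotone

/-- Reindexing: the free measure of any box `Λ_N ⊇ Λ_n` of the pulled-back event `A` of `Λ_n` is
`boxFreeReal d p q n A (N - n)`. [cite: Grimmett2006, Thm. (4.19)(a)] -/
theorem boxFreeReal_sub_eq {n N : ℕ} (h : n ≤ N) (p q : ℝ) (A : Set (Percolation.BondConfig ↥(box d n))) :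
    boxFreeReal d p q n A (N - n) =
      (rcMeasure (finsetGraph (zdGraph d) (box d N)) p q ∅).real (finsetRestrict (box_mono d h) ⁻¹' A) := by
  obtain ⟨k, rfl⟩ := Nat.exists_eq_add_of_le h
  rw [Nat.add_sub_cancel_left]
  rfl

/-- **The free box quantities increase with the box** (Grimmett 2006, Thm. (4.19)(a), proof,
eq. (4.24) with `b = 0`): `φ⁰_{Λ_{n+k}}(0 ↔ ∂Λ_n) ≤ φ⁰_{Λ_{n+k'}}(0 ↔ ∂Λ_n)` for `k ≤ k'`
(`0 ≤ p ≤ 1`, `q ≥ 1`; `{0 ↔ ∂Λ_n}` pulled back to `Λ_{n+k}` is increasing, and the free measure of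
the larger box restricted to `E_{Λ_{n+k}}` dominates that of the smaller box,
`rcMeasure_real_box_free_le_restrict`). [cite: Grimmett2006, Thm. (4.19)(a), proof, eq. (4.24)] -/
theorem thetaFreeBox_mono {p q : ℝ} (hp : p ∈ Set.Icc (0 : ℝ) 1) (hq : 1 ≤ q) (n : ℕ) {k k' : ℕ}
    (hkk' : k ≤ k') : thetaFreeBox d p q n k ≤ thetaFreeBox d p q n k' := by
  have hle : n + k ≤ n + k' := Nat.add_le_add_left hkk' n
  have hA : IsUpperSet (finsetRestrict (box_mono d (Nat.le_add_right n k)) ⁻¹' originToBoundary d n) :=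
    fun _ _ hω hmem => isUpperSet_originToBoundary d n (finsetRestrict_mono _ hω) hmem
  calc thetaFreeBox d p q n k
      ≤ (rcMeasure (finsetGraph (zdGraph d) (box d (n + k'))) p q ∅).real
          (finsetRestrict (box_mono d hle) ⁻¹'
            (finsetRestrict (box_mono d (Nat.le_add_right n k)) ⁻¹' originToBoundary d n)) :=
        rcMeasure_real_box_free_le_restrict hle hp hq hA
    _ = thetaFreeBox d p q n k' := by
        have hcomp : (finsetRestrict (box_mono d (Nat.le_add_right n k)) ∘ finsetRestrict (box_mono d hle)) =
            finsetRestrict (box_mono d (Nat.le_add_right n k')) :=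
          funext fun ω => finsetRestrict_finsetRestrict _ _ ω
        rw [thetaFreeBox_eq_real, ← Set.preimage_comp, hcomp]

/-- `k ↦ φ⁰_{Λ_{n+k}}(0 ↔ ∂Λ_n)` is monotone (`0 ≤ p ≤ 1`, `q ≥ 1`).
[cite: Grimmett2006, Thm. (4.19)(a), proof, eq. (4.24)] -/
theorem monotone_thetaFreeBox {p q : ℝ} (hp : p ∈ Set.Icc (0 : ℝ) 1) (hq : 1 ≤ q) (n : ℕ) :
    Monotone fun k : ℕ => thetaFreeBox d p q n k :=
  fun _ _ hkk' => thetaFreeBox_mono hp hq n hkk'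

/-- **`φ⁰_{Λ_{n+k},p,q}(0 ↔ ∂Λ_n) → φ⁰_{p,q}(0 ↔ ∂Λ_n)` as `k → ∞`** (monotone convergence): the
supremum `thetaFreeArm` is the limit of the free box probabilities, i.e. the free infinite-volume
probability of the cylinder event `{0 ↔ ∂Λ_n}` (Grimmett 2006, Thm. (4.19)(a): `φ⁰_{Λ,p,q} ⇒ φ⁰_{p,q}`
as `Λ ↑ ℤ^d`). [cite: Grimmett2006, Thm. (4.19)(a)] -/
theorem tendsto_thetaFreeBox {p q : ℝ} (hp : p ∈ Set.Icc (0 : ℝ) 1) (hq : 1 ≤ q) (n : ℕ) :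
    Tendsto (fun k : ℕ => thetaFreeBox d p q n k) atTop (𝓝 (thetaFreeArm d p q n)) :=
  tendsto_atTop_ciSup (monotone_thetaFreeBox hp hq n)
    (bddAbove_range_thetaFreeBox hp (one_pos.trans_le hq) n)

/-- Event inclusion across levels: if the origin is joined inside `Λ_{n'}` to `∂Λ_{n'}` in the
restriction of `ω ⊆ E_{Λ_N}` to `E_{Λ_{n'}}`, then (for `n ≤ n'`) it is joined inside `Λ_n` to
`∂Λ_n` in the restriction to `E_{Λ_n}` (the path must pass `∂Λ_n`; Grimmett 2006, proof of
Prop. (5.11): `{0 ↔ ∂Λ} ⊆ {0 ↔ ∂Δ}` for `Δ ⊆ Λ`). [cite: Grimmett2006, Prop. (5.11) (proof)] -/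
theorem finsetRestrict_mem_originToBoundary_of_le {n n' N : ℕ} (hnn' : n ≤ n') (hn'N : n' ≤ N)
    {ω : Percolation.BondConfig ↥(box d N)} (hω : ω ⊆ (finsetGraph (zdGraph d) (box d N)).edgeSet)
    (hmem : finsetRestrict (box_mono d hn'N) ω ∈ originToBoundary d n') :
    finsetRestrict (box_mono d (hnn'.trans hn'N)) ω ∈ originToBoundary d n := by
  have h := finsetRestrict_mem_originToBoundary hnn' (finsetRestrict_subset_edgeSet _ hω) hmem
  rwa [finsetRestrict_finsetRestrict] at h

/-- **The free arm probabilities decrease with the level**: `φ⁰_{p,q}(0 ↔ ∂Λ_{n'}) ≤ φ⁰_{p,q}(0 ↔ ∂Λ_n)`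
for `n ≤ n'` (`0 ≤ p ≤ 1`, `q > 0`), by the inclusion of events `{0 ↔ ∂Λ_{n'}} ⊆ {0 ↔ ∂Λ_n}` in
every box `Λ_{n'+k}`. [cite: Grimmett2006, Prop. (5.11) (proof) and §5.1 (5.1)] -/
theorem thetaFreeArm_anti {p q : ℝ} (hp : p ∈ Set.Icc (0 : ℝ) 1) (hq : 0 < q) {n n' : ℕ}
    (hnn' : n ≤ n') : thetaFreeArm d p q n' ≤ thetaFreeArm d p q n := by
  refine ciSup_le fun k => ?_
  have hnN : n ≤ n' + k := hnn'.trans (Nat.le_add_right n' k)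
  calc thetaFreeBox d p q n' k
      ≤ (rcMeasure (finsetGraph (zdGraph d) (box d (n' + k))) p q ∅).real
          (finsetRestrict (box_mono d hnN) ⁻¹' originToBoundary d n) :=
        rcMeasure_real_mono_on_edgeSets _ hp hq _ fun ω hω hmem =>
          finsetRestrict_mem_originToBoundary_of_le hnn' (Nat.le_add_right n' k) hω hmem
    _ = thetaFreeBox d p q n (n' + k - n) := (boxFreeReal_sub_eq hnN p q _).symm
    _ ≤ thetaFreeArm d p q n := thetaFreeBox_le_thetaFreeArm hp hq n _

/-- `n ↦ φ⁰_{p,q}(0 ↔ ∂Λ_n)` is antitone (`0 ≤ p ≤ 1`, `q > 0`). [cite: Grimmett2006, §5.1 (5.1)] -/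
theorem antitone_thetaFreeArm {p q : ℝ} (hp : p ∈ Set.Icc (0 : ℝ) 1) (hq : 0 < q) :
    Antitone fun n : ℕ => thetaFreeArm d p q n :=
  fun _ _ hnn' => thetaFreeArm_anti hp hq hnn'

/-- **`φ⁰_{p,q}(0 ↔ ∂Λ_n) → θ⁰(p,q)` as `n → ∞`** (monotone convergence: the events
`{0 ↔ ∂Λ_n}` decrease to `{0 ↔ ∞}`; Grimmett 2006, (5.1) with `b = 0`).
[cite: Grimmett2006, §5.1 (5.1)] -/
theorem tendsto_thetaFreeArm {p q : ℝ} (hp : p ∈ Set.Icc (0 : ℝ) 1) (hq : 0 < q) :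
    Tendsto (fun n : ℕ => thetaFreeArm d p q n) atTop (𝓝 (thetaFree d p q)) :=
  tendsto_atTop_ciInf (antitone_thetaFreeArm hp hq) (bddBelow_range_thetaFreeArm p q)

/-- **`θ⁰(p,q) = 0` iff the free box measures decay at the origin**: the barrier programme's
`freeDecaySet d q` (`RandomClusterFirstOrderProofs.lean`: `∀ ε > 0 ∃ m ∀ k, φ⁰_{Λ_{m+k}}(0 ↔ ∂Λ_m) ≤ ε`,
Grimmett's (7.81)–(7.82)) is exactly `{p : θ⁰(p,q) = 0}` (`0 ≤ p ≤ 1`, `q > 0`).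
[cite: Grimmett2006, proof of Thm. (7.33), eqs. (7.81)–(7.82), with §5.1 (5.1)] -/
theorem thetaFree_eq_zero_iff_mem_freeDecaySet {p q : ℝ} (hp : p ∈ Set.Icc (0 : ℝ) 1) (hq : 0 < q) :
    thetaFree d p q = 0 ↔ p ∈ freeDecaySet d q := by
  rw [mem_freeDecaySet_iff]
  constructor
  · intro h0 ε hε
    -- `inf_n thetaFreeArm = 0 < ε`, so some `thetaFreeArm n < ε`
    have hlt : ⨅ n : ℕ, thetaFreeArm d p q n < ε := by rw [← thetaFree_eq, h0]; exact hε
    obtain ⟨m, hm⟩ := exists_lt_of_ciInf_lt hlt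
    exact ⟨m, fun k => ((thetaFreeBox_le_thetaFreeArm hp hq m k).trans hm.le)⟩
  · intro h
    refine le_antisymm (le_of_forall_pos_le_add fun ε hε => ?_) (thetaFree_nonneg p q)
    rw [zero_add]
    obtain ⟨m, hm⟩ := h ε hε
    exact (thetaFree_le_thetaFreeArm p q m).trans (ciSup_le fun k => hm k)

end Monotone

/-! ### `θ⁰ ≤ θ¹` -/

section Comparison

/-- In dimension `d = 0` the box is a single point with empty boundary: `{0 ↔ ∂Λ_n} = ∅`.
[folklore] -/
private theorem originToBoundary_eq_empty_of_eq_zero (n : ℕ) : originToBoundary 0 n = ∅ := by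
  ext ω
  simp only [originToBoundary, boxBoundary, Set.mem_setOf_eq, mem_innerBoundary_iff, zdGraph_adj_iff,
    IsEmpty.exists_iff, and_false, exists_false, false_and, Set.mem_empty_iff_false]

/-- In dimension `d = 0`: `φ⁰_{Λ_{n+k}}(0 ↔ ∂Λ_n) = 0`. [folklore] -/
private theorem thetaFreeBox_of_eq_zero (p q : ℝ) (n k : ℕ) : thetaFreeBox 0 p q n k = 0 := by
  rw [thetaFreeBox_eq_real, originToBoundary_eq_empty_of_eq_zero, Set.preimage_empty, measureReal_empty]

/-- **Free box probability ≤ wired box probability of the same box**: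
`φ⁰_{Λ_{n+k},p,q}(0 ↔ ∂Λ_n) ≤ φ¹_{Λ_{n+k},p,q}(0 ↔ ∂Λ_n)` (`0 ≤ p ≤ 1`, `q ≥ 1`; wiring more is
stochastically larger on increasing events, Grimmett 2006 Lemma (4.14)(b)).
[cite: Grimmett2006, Lemma (4.14)(b)] -/
theorem thetaFreeBox_le_boxWiredReal {p q : ℝ} (hp : p ∈ Set.Icc (0 : ℝ) 1) (hq : 1 ≤ q) (n k : ℕ) :
    thetaFreeBox d p q n k ≤ boxWiredReal d p q n (originToBoundary d n) k :=
  rcMeasure_real_mono_wired_of_isUpperSet _ hp hq (Set.empty_subset _)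
    fun _ _ hω hmem => isUpperSet_originToBoundary d n (finsetRestrict_mono _ hω) hmem

/-- **`φ⁰_{p,q}(0 ↔ ∂Λ_n) ≤ φ¹_{Λ_n,p,q}(0 ↔ ∂Λ_n)`** (`0 ≤ p ≤ 1`, `q ≥ 1`): each free box probability
`φ⁰_{Λ_{n+k}}(0 ↔ ∂Λ_n)` is at most the wired one of the same box (Lemma (4.14)(b)), which is at
most `φ¹_{Λ_n}(0 ↔ ∂Λ_n)` since the wired box measures decrease with the box on increasing events
of `E_{Λ_n}` (Thm. (4.19)(a), (4.24) with `b = 1`, `rcMeasure_real_box_restrict_le`).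
[cite: Grimmett2006, Lemma (4.14)(b) and Thm. (4.19)(a), eq. (4.24)] -/
theorem thetaFreeArm_le_thetaWiredBox {p q : ℝ} (hp : p ∈ Set.Icc (0 : ℝ) 1) (hq : 1 ≤ q) (n : ℕ) :
    thetaFreeArm d p q n ≤ thetaWiredBox d p q n := by
  rcases Nat.eq_zero_or_pos d with rfl | hd
  · rw [thetaFreeArm_eq, thetaWiredBox_of_eq_zero]
    simp only [thetaFreeBox_of_eq_zero, ciSup_const, le_refl]
  refine ciSup_le fun k => ?_
  calc thetaFreeBox d p q n k
      ≤ boxWiredReal d p q n (originToBoundary d n) k := thetaFreeBox_le_boxWiredReal hp hq n k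
    _ ≤ thetaWiredBox d p q n := by
        rw [boxWiredReal, thetaWiredBox_eq_general]
        exact rcMeasure_real_box_restrict_le hd (Nat.le_add_right n k) hp hq
          (isUpperSet_originToBoundary d n)

/-- **`θ⁰(p,q) ≤ θ¹(p,q)`** on `ℤ^d` (`0 ≤ p ≤ 1`, `q ≥ 1`): `θ⁰ ≤ φ⁰_{p,q}(0 ↔ ∂Λ_{n+1}) ≤
φ¹_{Λ_{n+1}}(0 ↔ ∂Λ_{n+1})` for every `n`, and `θ¹ = inf_n` of the right side. (Grimmett 2006:
`φ⁰_{p,q} ≤_st φ¹_{p,q}`, Thm. (4.19)(c) eq. (4.21), applied to `{0 ↔ ∞}`.)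
[cite: Grimmett2006, Thm. (4.19)(c) (4.21), Lemma (4.14)(b) and §5.1 (5.1)] -/
theorem thetaFree_le_thetaWired {p q : ℝ} (hp : p ∈ Set.Icc (0 : ℝ) 1) (hq : 1 ≤ q) :
    thetaFree d p q ≤ thetaWired d p q :=
  le_ciInf fun n => (thetaFree_le_thetaFreeArm p q (n + 1)).trans (thetaFreeArm_le_thetaWiredBox hp hq (n + 1))

/-- `θ¹(p,q) ≤ inf_k φ¹_{Λ_{n+k},p,q}(0 ↔ ∂Λ_n)` for every level `n` (`0 ≤ p ≤ 1`, `q ≥ 1`):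
`θ¹ ≤ φ¹_{Λ_{n+k}}(0 ↔ ∂Λ_{n+k}) ≤ φ¹_{Λ_{n+k}}(0 ↔ ∂Λ_n)` (event inclusion of the proof of
Prop. (5.11)). [cite: Grimmett2006, Prop. (5.11) (proof)] -/
theorem thetaWired_le_iInf_boxWiredReal {p q : ℝ} (hp : p ∈ Set.Icc (0 : ℝ) 1) (hq : 1 ≤ q) (n : ℕ) :
    thetaWired d p q ≤ ⨅ k : ℕ, boxWiredReal d p q n (originToBoundary d n) k :=
  le_ciInf fun k => (thetaWired_le_thetaWiredBox' d hp hq (n + k)).trans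
    (thetaWiredBox_add_le_boxWiredReal hp (one_pos.trans_le hq) n k)

end Comparison

/-! ### Grimmett's Thm. (5.16)(c): equal edge densities force `θ⁰ = θ¹` -/

section Seam

/-- **At a parameter of equal edge densities, `θ¹(p,q) ≤ φ⁰_{p,q}(0 ↔ ∂Λ_n)` for every `n`**
(`d ≥ 1`, `0 ≤ p ≤ 1`, `q ≥ 1`, `h⁰(p,q) = h¹(p,q)` at every edge): `θ¹ ≤ inf_k φ¹_{Λ_{n+k}}(0 ↔ ∂Λ_n)
≤ sup_k φ⁰_{Λ_{n+k}}(0 ↔ ∂Λ_n)`, the second step being the tree's finite-volume form of Grimmett's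
Thm. (4.63) (c) ⇒ (d) for the increasing box event `{0 ↔ ∂Λ_n}`
(`iInf_boxWiredReal_le_iSup_boxFreeReal`). [cite: Grimmett2006, Thm. (4.63) ((c) ⇒ (d)) and Thm. (5.16)(c)] -/
theorem thetaWired_le_thetaFreeArm_of_edgeDensity_eq (hd : 0 < d) {p q : ℝ} (hp : p ∈ Set.Icc (0 : ℝ) 1)
    (hq : 1 ≤ q) (hgood : ∀ e ∈ (zdGraph d).edgeSet, freeEdgeDensity d p q e = wiredEdgeDensity d p q e)
    (n : ℕ) : thetaWired d p q ≤ thetaFreeArm d p q n :=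
  (thetaWired_le_iInf_boxWiredReal hp hq n).trans
    (iInf_boxWiredReal_le_iSup_boxFreeReal hd hp hq hgood n (isUpperSet_originToBoundary d n))

/-- **`θ¹(p,q) ≤ θ⁰(p,q)` at a parameter of equal edge densities** (`d ≥ 1`, `0 ≤ p ≤ 1`, `q ≥ 1`).
[cite: Grimmett2006, Thm. (4.63) ((c) ⇒ (d)) and Thm. (5.16)(c)] -/
theorem thetaWired_le_thetaFree_of_edgeDensity_eq (hd : 0 < d) {p q : ℝ} (hp : p ∈ Set.Icc (0 : ℝ) 1)
    (hq : 1 ≤ q) (hgood : ∀ e ∈ (zdGraph d).edgeSet, freeEdgeDensity d p q e = wiredEdgeDensity d p q e) :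
    thetaWired d p q ≤ thetaFree d p q :=
  le_ciInf fun n => thetaWired_le_thetaFreeArm_of_edgeDensity_eq hd hp hq hgood n

/-- **Grimmett 2006, Thm. (5.16)(c), the 'if' half: `h⁰(p,q) = h¹(p,q)` implies
`θ⁰(p,q) = θ¹(p,q)`.** For the random-cluster model on `ℤ^d`, `d ≥ 1`, `0 ≤ p ≤ 1`, `q ≥ 1`: if the
free and wired edge densities agree at `p` (at every edge; by automorphism invariance (4.61) one
edge suffices, and by Thm. (4.63) (a)⇔(c) this says `p ∉ 𝒟_q`, equivalently (d) `φ⁰_{p,q} = φ¹_{p,q}`),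
then the free and wired percolation probabilities agree. As printed: "Certainly
`φ⁰_{p,q} = φ¹_{p,q}` if `p ∉ 𝒟_q` (by Theorem 4.63), whence `θ⁰(p,q) = θ¹(p,q)`." Here:
`θ⁰ ≤ θ¹` always (`thetaFree_le_thetaWired`), and `θ¹ ≤ θ⁰` from the finite-volume Thm. (4.63)
(c) ⇒ (d) applied to the increasing events `{0 ↔ ∂Λ_n}`. (The converse half of (c),
eqs. (5.20)–(5.26), is not formalised.) [cite: Grimmett2006, Thm. (5.16)(c) with Thm. (4.63)] -/
theorem thetaFree_eq_thetaWired_of_edgeDensity_eq (hd : 0 < d) {p q : ℝ} (hp : p ∈ Set.Icc (0 : ℝ) 1)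
    (hq : 1 ≤ q) (hgood : ∀ e ∈ (zdGraph d).edgeSet, freeEdgeDensity d p q e = wiredEdgeDensity d p q e) :
    thetaFree d p q = thetaWired d p q :=
  le_antisymm (thetaFree_le_thetaWired hp hq) (thetaWired_le_thetaFree_of_edgeDensity_eq hd hp hq hgood)

end Seam

/-! ### The FK–Ising case `q = 2`: `θ⁰(p,2) = θ¹(p,2)` at every `p`, from one nearest-neighbour identity -/

section Ising

/-- **`θ⁰(p,2) = θ¹(p,2)` at `p = 1 - e^{-2β}` from ONE nearest-neighbour identity** (`β ≥ 0`): if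
`⟨σ_0σ_{eᵢ}⟩^∅_{β,0} = ⟨σ_0σ_{eᵢ}⟩⁺_{β,0}` for one direction `i` of `ℤ^d`, then `h⁰(p,2) = h¹(p,2)`
at every edge (the tree's Edwards–Sokal edge-density dictionary
`freeEdgeDensity_eq_wiredEdgeDensity_of_nn_freeCorr_eq_plusCorr`, Grimmett 2006 Thm. (4.91)(b) at
`q = 2` with (4.61)), hence `θ⁰(p,2) = θ¹(p,2)` by Thm. (5.16)(c).
[cite: Grimmett2006, Thm. (5.16)(c), Thm. (4.63) and Thm. (4.91)(b)] -/
theorem thetaFree_eq_thetaWired_two_of_nn_freeCorr_eq_plusCorr {β : ℝ} (hβ : 0 ≤ β) (i : Fin d)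
    (h : freeCorr d β 0 {0, Pi.single i 1} = plusCorr d β 0 {0, Pi.single i 1}) :
    thetaFree d (fkIsingParam β) 2 = thetaWired d (fkIsingParam β) 2 :=
  thetaFree_eq_thetaWired_of_edgeDensity_eq i.pos (fkIsingParam_mem_Icc hβ) (by norm_num)
    fun _ he => freeEdgeDensity_eq_wiredEdgeDensity_of_nn_freeCorr_eq_plusCorr hβ i h he

/-- **`θ⁰(p,2) = θ¹(p,2)` for FK–Ising on `ℤ^d` at EVERY `p = 1 - e^{-2β}`, `β ≥ 0`, `d ≥ 1`, from
Raoufi's Proposition 1** (conditional on the tree's named fact `Raoufi2020_nn_freeCorr_eq_plusCorr`: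
`⟨σ_0σ_{eᵢ}⟩⁺_β = ⟨σ_0σ_{eᵢ}⟩^∅_β`; Raoufi 2020, Prop. 1, whose Cor. 3 is the uniqueness of the
infinite-volume FK–Ising measure at every `p`): by the dictionary the edge densities agree, so
Grimmett 2006 Thm. (5.16)(c) gives `θ⁰ = θ¹` — no boundary-condition seam for `q = 2`, at any `p`,
in particular at `p_c(2)`. [cite: Raoufi2020, Prop. 1 and Cor. 3; Grimmett2006, Thm. (5.16)(c) with Thm. (4.63)] -/
theorem thetaFree_eq_thetaWired_two_of_raoufi (h : Raoufi2020_nn_freeCorr_eq_plusCorr) (hd : 1 ≤ d)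
    {β : ℝ} (hβ : 0 ≤ β) : thetaFree d (fkIsingParam β) 2 = thetaWired d (fkIsingParam β) 2 :=
  thetaFree_eq_thetaWired_two_of_nn_freeCorr_eq_plusCorr hβ ⟨0, hd⟩ (h d β hd hβ ⟨0, hd⟩)

/-- **At the critical point: `θ⁰(p_c(2), 2) = θ¹(p_c(2), 2)` on `ℤ^d`, `d ≥ 2`**, conditional on
`Raoufi2020_nn_freeCorr_eq_plusCorr` — with `p_c(2) = 1 - e^{-2β_c(d)}`
(`rcCriticalProb_two_eq_fkIsingParam_criticalBeta`, Grimmett 2006 (5.2) with Thm. (5.17)) this is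
the previous theorem at `β = β_c(d)`. This is the boundary-condition hypothesis ("uniqueness at
the working point `p_c(2)`") under which wired finite-volume inputs transfer to the free phase.
[cite: Raoufi2020, Prop. 1 and Cor. 3; Grimmett2006, Thm. (5.16)(c) and (5.2), Thm. (5.17)] -/
theorem thetaFree_rcCriticalProb_two_eq_thetaWired_of_raoufi (h : Raoufi2020_nn_freeCorr_eq_plusCorr)
    (hd : 2 ≤ d) : thetaFree d (rcCriticalProb d 2) 2 = thetaWired d (rcCriticalProb d 2) 2 := by
  rw [rcCriticalProb_two_eq_fkIsingParam_criticalBeta hd]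
  exact thetaFree_eq_thetaWired_two_of_raoufi h (by omega) (criticalBeta_nonneg d)

/-- **`θ⁰(p_c(2), 2) = 0` on `ℤ^d`, `d ≥ 3`**, conditional on `Raoufi2020_nn_freeCorr_eq_plusCorr`:
the free FK–Ising model does not percolate at its critical point either — from
`θ⁰(p_c(2),2) = θ¹(p_c(2),2)` (previous theorem) and the tree theorem `θ¹(p_c(2),2) = 0`
(`thetaWired_rcCriticalProb_two_eq_zero`: Aizenman–Duminil-Copin–Sidoravicius 2015 through
Grimmett's (5.19)). (Unconditionally `0 ≤ θ⁰ ≤ θ¹ = 0` already gives this — see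
`thetaFree_rcCriticalProb_two_eq_zero`; the point of the conditional form is the equality of the
two phases.) [cite: AizenmanDuminilCopinSidoraviciusCMP2015, Thm. 1.2 with Cor. 1.5 (1); Grimmett2006, Thm. (5.16)(c)] -/
theorem thetaFree_rcCriticalProb_two_eq_zero_of_raoufi (h : Raoufi2020_nn_freeCorr_eq_plusCorr)
    (hd : 3 ≤ d) : thetaFree d (rcCriticalProb d 2) 2 = 0 := by
  rw [thetaFree_rcCriticalProb_two_eq_thetaWired_of_raoufi h (by omega)]
  exact thetaWired_rcCriticalProb_two_eq_zero hd

/-- **`θ⁰(p_c(2), 2) = 0` on `ℤ^d`, `d ≥ 3`, unconditionally**: `0 ≤ θ⁰ ≤ θ¹` and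
`θ¹(p_c(2), 2) = 0` (`thetaWired_rcCriticalProb_two_eq_zero`, Aizenman–Duminil-Copin–Sidoravicius
2015 through Grimmett's (5.19); `p_c(2) ∈ [0,1]`).
[cite: AizenmanDuminilCopinSidoraviciusCMP2015, Thm. 1.2 with Cor. 1.5 (1); Grimmett2006, §5.1 (5.1)–(5.3)] -/
theorem thetaFree_rcCriticalProb_two_eq_zero (hd : 3 ≤ d) : thetaFree d (rcCriticalProb d 2) 2 = 0 := by
  have hp : rcCriticalProb d 2 ∈ Set.Icc (0 : ℝ) 1 := by
    rw [rcCriticalProb_two_eq_fkIsingParam_criticalBeta (by omega)]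
    exact fkIsingParam_mem_Icc (criticalBeta_nonneg d)
  refine le_antisymm ?_ (thetaFree_nonneg _ _)
  calc thetaFree d (rcCriticalProb d 2) 2 ≤ thetaWired d (rcCriticalProb d 2) 2 :=
        thetaFree_le_thetaWired hp (by norm_num)
    _ = 0 := thetaWired_rcCriticalProb_two_eq_zero hd

end Ising

end Literature.Probability.LatticeModels

end
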